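import Mathlib.Analysis.FunctionalSpaces.SobolevInequality
import Literature.Analysis.FluidPDE.HessianLaplacianLpProofs
import Literature.Analysis.FluidPDE.NewtonLocalPotentialCalculus
import Literature.Analysis.FluidPDE.PressurePoisson
import Literature.Analysis.FluidPDE.WholeSpaceIBP
import HarnessLib

/-!
# The localised Helmholtz potential of a smooth compactly supported field (slice level)

Analysis/FluidPDE support file (everything proved, no named facts) in the decomposition of the
named fact `Literature.Analysis.FluidPDE.lemarieRieusset_epsilon_regularity_nu_one`
(`CKNEpsilonRegularityViscosity`; Lemarié-Rieusset 2016, Thm. 14.4 at `ν = 1`, `r₀ = 1`). The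
first local regularity theorem in Robinson–Rodrigo–Sadowski's form (`CKNLocalRegularityRRS`,
`CKNLocalRegularityRRSGlueLR`) reaches Thm. 14.4 only for a *solenoidal* force, because its
Step 3 uses the pressure equation `-Δp = ∂ᵢ∂ⱼ(uᵢuⱼ)`; for a general force `f ∈ L^q` one first
absorbs the gradient part of (a localisation of) `f` into the pressure (Caffarelli–Kohn–Nirenberg
1982, §1: "if `f` is not divergence-free, its gradient part can be absorbed into the pressure").
This file is the smooth, fixed-time core of that absorption. For a smooth compactly supported
field `w : ℝ³ → ℝ³` put

  `P[w] = N[div w]`,  `N = newtonNearPotential 4 8` (the truncated Newtonian potential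
  `N[g] = Γ₀ * g`, `Γ₀ = θΓ`, `= Γ` on `|z| ≤ 4`, supported in `|z| ≤ 8`).

Then (all proved here):

* `P[w]` is smooth with compact support, linear in `w`, and `P[w] = Σᵢ ∂ᵢ N[wᵢ]`
  (`potential_eq_sum_fderiv`), so that `∂ₐP[w] = Σᵢ ∂ₐ∂ᵢN[wᵢ]` is a sum of Hessian entries of
  truncated Newtonian potentials; by the tree's Calderón–Zygmund bound
  (`stein1970_hessian_Lp_bound_holds_fin3` with `hessian_newtonNearPotential_half` at `r = 8`)
  `‖∇P[w]‖_{L^p} ≤ C_p ‖w‖_{L^p}` for every `1 < p < ∞` (`exists_eLpNorm_gradient_potential_le`);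
* `ΔP[w] = div w - Λ[div w]` with the smoothing remainder `Λ = newtonFarSmoothing 4 8`, whose
  kernel lives in the annulus `4 ≤ |z| ≤ 8`; hence if `w` is supported in a ball `B(c, 2)` then
  `ΔP[w] = div w` on `B(c, 2)` and the field `w - ∇P[w]` is divergence free there
  (`divergence_sub_gradient_potential_eq_zero`): the gradient part of `w` has been removed on
  the ball;
* by the Gagliardo–Nirenberg–Sobolev inequality of Mathlib (`p = 3/2`, `p* = 3`, dimension `3`)
  and the Calderón–Zygmund bound at `p = 3/2`, `‖P[w]‖_{L³} ≤ C ‖w‖_{L^{3/2}}`; as `P[w]` is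
  supported in `B̄(c, 10)`, also `‖P[w]‖_{L^{3/2}} ≤ C' ‖w‖_{L^{3/2}}`
  (`exists_eLpNorm_potential_le`). All constants are absolute (independent of the centre `c`).

The space–time objects (mollification of `1_{Q₁} f`, limits in `L^q`) are built on this in
`LocalHelmholtzForce`.

## References

* L. Caffarelli, R. Kohn, L. Nirenberg, *Partial regularity of suitable weak solutions of the
  Navier–Stokes equations*, Comm. Pure Appl. Math. 35 (1982), 771–831, §1–§2 (absorbing the
  gradient part of the force into the pressure). [CaffarelliKohnNirenberg1982]
* E. M. Stein, *Singular integrals and differentiability properties of functions* (1970),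
  Ch. III §1.3, Prop. 3. [Stein1971]
* P. G. Lemarié-Rieusset, *The Navier–Stokes Problem in the 21st Century*, CRC Press (2016),
  Thm. 14.4. [LemarieRieusset2016]
-/

noncomputable section

open MeasureTheory Set Function Filter Topology TopologicalSpace Metric InnerProductSpace
open scoped NNReal ENNReal RealInnerProductSpace Laplacian ContDiff

namespace Literature.Analysis.FluidPDE

namespace LocalHelmholtz

/-- Local notation for physical space `ℝ³ = EuclideanSpace ℝ (Fin 3)`. -/
local notation "ℝ³" => EuclideanSpace ℝ (Fin 3)

/-- The standard orthonormal basis `e₀, e₁, e₂` of `ℝ³`. -/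
local notation "𝐞" => EuclideanSpace.basisFun (Fin 3) ℝ

variable {w w₁ w₂ : ℝ³ → ℝ³}

/-- The standard basis vectors have norm one. [folklore] -/
theorem norm_basisFun (i : Fin 3) : ‖(𝐞 i : ℝ³)‖ = 1 := (𝐞).orthonormal.1 i

/-! ### The divergence of a smooth compactly supported field -/

/-- The `i`-th component `wᵢ = ⟪w, eᵢ⟫` of a field. [folklore] -/
def comp (w : ℝ³ → ℝ³) (i : Fin 3) (y : ℝ³) : ℝ := ⟪w y, 𝐞 i⟫

/-- Unfolding `comp`. [folklore] -/
theorem comp_apply (w : ℝ³ → ℝ³) (i : Fin 3) (y : ℝ³) : comp w i y = ⟪w y, 𝐞 i⟫ := rfl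

/-- Components of a `Cⁿ` field are `Cⁿ`. [folklore] -/
theorem contDiff_comp {n : WithTop ℕ∞} (hw : ContDiff ℝ n w) (i : Fin 3) :
    ContDiff ℝ n (comp w i) :=
  hw.inner ℝ contDiff_const

/-- Components of a continuous field are continuous. [folklore] -/
theorem continuous_comp (hw : Continuous w) (i : Fin 3) : Continuous (comp w i) :=
  hw.inner continuous_const

/-- Components of a compactly supported field have compact support. [folklore] -/
theorem hasCompactSupport_comp (hwc : HasCompactSupport w) (i : Fin 3) :
    HasCompactSupport (comp w i) :=
  hwc.mono fun y hy => by
    contrapose! hy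
    simp only [mem_support, not_not] at hy ⊢
    simp [comp, hy]

/-- `|wᵢ| ≤ ‖w‖`. [folklore] -/
theorem abs_comp_le (w : ℝ³ → ℝ³) (i : Fin 3) (y : ℝ³) : |comp w i y| ≤ ‖w y‖ := by
  rw [comp_apply]
  refine (abs_real_inner_le_norm _ _).trans ?_
  rw [norm_basisFun, mul_one]

/-- Components are linear. [folklore] -/
theorem comp_sub (w₁ w₂ : ℝ³ → ℝ³) (i : Fin 3) :
    comp (w₁ - w₂) i = comp w₁ i - comp w₂ i := by
  funext y; simp [comp, inner_sub_left]

/-- `∂ᵥ wᵢ = ⟪∂ᵥ w, eᵢ⟫`. [folklore] -/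
theorem fderiv_comp_apply (hw : ContDiff ℝ 1 w) (i : Fin 3) (y v : ℝ³) :
    fderiv ℝ (comp w i) y v = ⟪fderiv ℝ w y v, 𝐞 i⟫ := by
  have hd : DifferentiableAt ℝ w y := hw.differentiable one_ne_zero y
  change fderiv ℝ (fun y => ⟪w y, 𝐞 i⟫) y v = _
  rw [fderiv_inner_apply ℝ hd (differentiableAt_const _), fderiv_fun_const]
  simp

/-- `div w = Σᵢ ∂ᵢ wᵢ` in the standard basis. [folklore] -/
theorem divergence_eq_sum_fderiv_comp (hw : ContDiff ℝ 1 w) (y : ℝ³) :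
    VectorCalculus.divergence w y = ∑ i, fderiv ℝ (comp w i) y (𝐞 i) := by
  rw [divergence_eq_sum_inner_fderiv 𝐞]
  refine Finset.sum_congr rfl fun i _ => ?_
  rw [fderiv_comp_apply hw, real_inner_comm]

/-- The divergence of a `C^{n+1}` field is `Cⁿ`. [folklore] -/
theorem contDiff_divergence' {n : ℕ∞} (hw : ContDiff ℝ (n + 1) w) :
    ContDiff ℝ n (VectorCalculus.divergence w) := by
  have h1 : ContDiff ℝ 1 w := hw.of_le (by
    exact le_add_self)
  have hfun : VectorCalculus.divergence w = fun y => ∑ i, fderiv ℝ (comp w i) y (𝐞 i) :=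
    funext fun y => divergence_eq_sum_fderiv_comp h1 y
  rw [hfun]
  refine ContDiff.sum fun i _ => ?_
  have hci : ContDiff ℝ (n + 1) (comp w i) := contDiff_comp hw i
  exact (hci.fderiv_right (m := n) le_rfl).clm_apply contDiff_const

/-- The divergence of a smooth field is smooth. [folklore] -/
theorem contDiff_divergence_top (hw : ContDiff ℝ ∞ w) :
    ContDiff ℝ ∞ (VectorCalculus.divergence w) := by
  rw [contDiff_infty]
  intro n
  exact contDiff_divergence' (n := n) (contDiff_infty.1 hw (n + 1))

/-- The divergence vanishes off the topological support of the field. [folklore] -/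
theorem tsupport_divergence_subset (w : ℝ³ → ℝ³) :
    tsupport (VectorCalculus.divergence w) ⊆ tsupport w := by
  refine closure_minimal (fun y hy => ?_) (isClosed_tsupport w)
  contrapose! hy
  simp only [mem_support, not_not]
  exact divergence_eq_zero_of_notMem_tsupport hy

/-- The divergence of a compactly supported field has compact support. [folklore] -/
theorem hasCompactSupport_divergence' (hwc : HasCompactSupport w) :
    HasCompactSupport (VectorCalculus.divergence w) :=
  hwc.mono' ((subset_tsupport _).trans (tsupport_divergence_subset w))

/-! ### The potential `P[w] = N[div w]` -/

/-- **The localised Helmholtz potential** `P[w] = N_{4,8}[div w]` of a field `w : ℝ³ → ℝ³`: the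
truncated Newtonian potential (radii `(4, 8)`) of its divergence. For `w` supported in a ball of
radius `2`, `∇P[w]` is the gradient part of `w` on that ball (`ΔP[w] = div w` there).
[cite: CaffarelliKohnNirenberg1982, §1 (gradient part of the force absorbed into the pressure)] -/
def potential (w : ℝ³ → ℝ³) : ℝ³ → ℝ :=
  newtonNearPotential 4 8 (VectorCalculus.divergence w)

/-- Unfolding `potential`. [folklore] -/
theorem potential_def (w : ℝ³ → ℝ³) :
    potential w = newtonNearPotential 4 8 (VectorCalculus.divergence w) := rfl

/-- The radii `0 ≤ 4 < 8` of the truncated kernel. [folklore] -/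
private theorem h48 : (0 : ℝ) ≤ 4 ∧ (4 : ℝ) < 8 := ⟨by norm_num, by norm_num⟩

/-- `P[w]` is smooth for smooth `w`. [folklore] -/
theorem contDiff_potential (hw : ContDiff ℝ ∞ w) : ContDiff ℝ ∞ (potential w) :=
  contDiff_newtonNearPotential_top h48.1 h48.2 (contDiff_divergence_top hw)

/-- `P[w]` has compact support for compactly supported `w`. [folklore] -/
theorem hasCompactSupport_potential (hwc : HasCompactSupport w) :
    HasCompactSupport (potential w) :=
  hasCompactSupport_newtonNearPotential h48.1 h48.2 (hasCompactSupport_divergence' hwc)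

/-- Locality: `P[w](x) = 0` as soon as `w` vanishes identically on `B̄(x, 8)` in the sense that
`tsupport w ⊆ B(c, R)` and `‖x - c‖ ≥ R + 8`. [folklore] -/
theorem potential_eq_zero_of_far {c : ℝ³} {R : ℝ} (hsupp : tsupport w ⊆ ball c R) {x : ℝ³}
    (hx : R + 8 ≤ dist x c) : potential w x = 0 := by
  refine newtonNearPotential_eq_zero_of_forall h48.1 h48.2 fun z hz => ?_
  refine divergence_eq_zero_of_notMem_tsupport fun hmem => ?_
  have h1 : dist (x - z) c < R := mem_ball.1 (hsupp hmem)
  have h2 : dist x c ≤ dist (x - z) c + ‖z‖ := by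
    calc dist x c = ‖(x - z - c) + z‖ := by rw [dist_eq_norm]; congr 1; abel
      _ ≤ ‖x - z - c‖ + ‖z‖ := norm_add_le _ _
      _ = dist (x - z) c + ‖z‖ := by rw [dist_eq_norm]
  linarith

/-- The support of `P[w]`: if `tsupport w ⊆ B(c, R)` then `P[w]` vanishes off `B(c, R + 8)`,
so `tsupport P[w] ⊆ B̄(c, R + 8)`. [folklore] -/
theorem tsupport_potential_subset {c : ℝ³} {R : ℝ} (hsupp : tsupport w ⊆ ball c R) :
    tsupport (potential w) ⊆ closedBall c (R + 8) := by
  refine closure_minimal (fun x hx => ?_) isClosed_closedBall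
  rw [mem_closedBall]
  by_contra h
  exact hx (potential_eq_zero_of_far hsupp (not_le.1 h).le)

/-- **`P[w] = Σᵢ ∂ᵢ N[wᵢ]`**: the potential of the divergence is the sum of the first
derivatives of the potentials of the components (`N[∂ᵢwᵢ] = ∂ᵢN[wᵢ]`). [folklore] -/
theorem potential_eq_sum_fderiv (hw : ContDiff ℝ ∞ w) (x : ℝ³) :
    potential w x = ∑ i, fderiv ℝ (newtonNearPotential 4 8 (comp w i)) x (𝐞 i) := by
  have h1 : ContDiff ℝ 1 w := contDiff_infty.1 hw 1
  have hfun : VectorCalculus.divergence w = fun y => ∑ i, fderiv ℝ (comp w i) y (𝐞 i) :=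
    funext fun y => divergence_eq_sum_fderiv_comp h1 y
  rw [potential, hfun, newtonNearPotential_finset_sum h48.1 h48.2]
  · refine Finset.sum_congr rfl fun i _ => ?_
    rw [fderiv_newtonNearPotential_apply h48.1 h48.2 (contDiff_infty.1 (contDiff_comp hw i) 1)]
  · intro i _
    exact ((contDiff_infty.1 (contDiff_comp hw i) 1).continuous_fderiv one_ne_zero).clm_apply
      continuous_const

/-- **`∂ₐP[w] = Σᵢ ∂ₐ∂ᵢ N[wᵢ]`**: the gradient of the potential is a sum of Hessian entries of
truncated Newtonian potentials. [folklore] -/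
theorem fderiv_potential_apply (hw : ContDiff ℝ ∞ w) (x a : ℝ³) :
    fderiv ℝ (potential w) x a =
      ∑ i, fderiv ℝ (fun y => fderiv ℝ (newtonNearPotential 4 8 (comp w i)) y (𝐞 i)) x a := by
  have hfun : potential w = fun y => ∑ i, fderiv ℝ (newtonNearPotential 4 8 (comp w i)) y (𝐞 i) :=
    funext fun y => potential_eq_sum_fderiv hw y
  have hd : ∀ i, DifferentiableAt ℝ
      (fun y => fderiv ℝ (newtonNearPotential 4 8 (comp w i)) y (𝐞 i)) x := by
    intro i
    have hN : ContDiff ℝ ∞ (newtonNearPotential 4 8 (comp w i)) :=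
      contDiff_newtonNearPotential_top h48.1 h48.2 (contDiff_comp hw i)
    exact ((((contDiff_infty.1 hN 2).fderiv_right (m := 1) le_rfl).clm_apply
      contDiff_const).differentiable one_ne_zero) x
  rw [hfun, fderiv_fun_sum fun i _ => hd i, _root_.FunLike.coe_sum, Finset.sum_apply]

/-- Linearity: `P[w₁ - w₂] = P[w₁] - P[w₂]` for `C¹` fields. [folklore] -/
theorem potential_sub (hw₁ : ContDiff ℝ 1 w₁) (hw₂ : ContDiff ℝ 1 w₂) :
    potential (w₁ - w₂) = potential w₁ - potential w₂ := by
  have hdiv : VectorCalculus.divergence (w₁ - w₂) =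
      fun y => VectorCalculus.divergence w₁ y + (-1 : ℝ) * VectorCalculus.divergence w₂ y := by
    funext y
    have := divergence_sub_apply (hw₁.differentiable one_ne_zero y) (hw₂.differentiable one_ne_zero y)
    rw [show (w₁ - w₂) = fun y => w₁ y - w₂ y from rfl, this]
    ring
  have hc₁ : Continuous (VectorCalculus.divergence w₁) :=
    continuous_divergence (hw₁.continuous_fderiv one_ne_zero)
  have hc₂ : Continuous fun y => (-1 : ℝ) * VectorCalculus.divergence w₂ y :=
    continuous_const.mul (continuous_divergence (hw₂.continuous_fderiv one_ne_zero))
  funext x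
  rw [potential, hdiv, Pi.sub_apply, potential, potential]
  rw [show (fun y => VectorCalculus.divergence w₁ y + (-1 : ℝ) * VectorCalculus.divergence w₂ y) =
      (VectorCalculus.divergence w₁ + fun y => (-1 : ℝ) * VectorCalculus.divergence w₂ y) from rfl,
    newtonNearPotential_add h48.1 h48.2 hc₁ hc₂, newtonNearPotential_const_mul]
  ring

/-! ### The Calderón–Zygmund bound for `∇P[w]` -/

/-- **Calderón–Zygmund bound for the directional derivatives of `P[w]`**: for `1 < p < ∞` there
is `C = C(p)` with `‖∂ₐ P[w]‖_{L^p} ≤ C ‖w‖_{L^p}` for all smooth compactly supported `w` and all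
`‖a‖ ≤ 1` (each `∂ₐ∂ᵢN[wᵢ]` is bounded by the tree's discharged Stein bound, and `|wᵢ| ≤ |w|`).
[cite: Stein1971, Ch. III §1.3 Prop 3] -/
theorem exists_eLpNorm_fderiv_potential_le {p : ℝ≥0∞} (hp : 1 < p) (hp' : p < ⊤) :
    ∃ C : ℝ≥0, ∀ ⦃w : ℝ³ → ℝ³⦄, ContDiff ℝ ∞ w → HasCompactSupport w → ∀ a : ℝ³, ‖a‖ ≤ 1 →
      eLpNorm (fun x => fderiv ℝ (potential w) x a) p volume ≤ C * eLpNorm w p volume := by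
  obtain ⟨C, hC⟩ := stein1970_hessian_Lp_bound_holds_fin3.hessian_newtonNearPotential_half hp hp'
  have hC' : ∀ ⦃g : ℝ³ → ℝ⦄, ContDiff ℝ 2 g → HasCompactSupport g → ∀ a b : ℝ³, ‖a‖ ≤ 1 →
      ‖b‖ ≤ 1 →
      eLpNorm (fun x => fderiv ℝ (fun y => fderiv ℝ (newtonNearPotential 4 8 g) y a) x b) p volume
        ≤ C * eLpNorm g p volume := by
    intro g hg hgc a b ha hb
    have h := hC (by norm_num : (0 : ℝ) < 8) hg hgc a b ha hb
    rw [show (8 : ℝ) / 2 = 4 by norm_num] at h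
    exact h
  refine ⟨3 * C, fun w hw hwc a ha => ?_⟩
  set F : Fin 3 → ℝ³ → ℝ := fun i x =>
    fderiv ℝ (fun y => fderiv ℝ (newtonNearPotential 4 8 (comp w i)) y (𝐞 i)) x a with hF
  have hfun : (fun x => fderiv ℝ (potential w) x a) = ∑ i, F i := by
    funext x
    rw [fderiv_potential_apply hw x a, Finset.sum_apply]
  have hmeas : ∀ i, AEStronglyMeasurable (F i) volume := by
    intro i
    have hN : ContDiff ℝ 2 (newtonNearPotential 4 8 (comp w i)) :=
      contDiff_infty.1 (contDiff_newtonNearPotential_top h48.1 h48.2 (contDiff_comp hw i)) 2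
    exact (FluidPDE.continuous_fderiv_fderiv_apply hN _ _).aestronglyMeasurable
  have hFi : ∀ i, eLpNorm (F i) p volume ≤ C * eLpNorm w p volume := by
    intro i
    refine (hC' (contDiff_infty.1 (contDiff_comp hw i) 2) (hasCompactSupport_comp hwc i) (𝐞 i) a
      (norm_basisFun i).le ha).trans ?_
    refine mul_le_mul_right ?_ _
    exact (eLpNorm_mono_real (g := fun y => ‖w y‖) fun y => by
      rw [Real.norm_eq_abs]; exact abs_comp_le w i y).trans_eq (eLpNorm_norm w)
  rw [hfun]
  calc eLpNorm (∑ i, F i) p volume ≤ ∑ i, eLpNorm (F i) p volume :=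
        eLpNorm_sum_le (fun i _ => hmeas i) hp.le
    _ ≤ ∑ _i : Fin 3, (C : ℝ≥0∞) * eLpNorm w p volume := Finset.sum_le_sum fun i _ => hFi i
    _ = (3 * C : ℝ≥0) * eLpNorm w p volume := by
        rw [Finset.sum_const, Finset.card_univ, Fintype.card_fin]
        push_cast
        ring

/-- `‖v‖ ≤ Σᵢ |⟪v, eᵢ⟫|` in `ℝ³`. [folklore] -/
theorem norm_le_sum_abs_inner_basisFun (v : ℝ³) : ‖v‖ ≤ ∑ i, |⟪v, 𝐞 i⟫| := by
  have h := (𝐞).sum_repr' v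
  calc ‖v‖ = ‖∑ i, ⟪𝐞 i, v⟫ • (𝐞 i : ℝ³)‖ := by rw [h]
    _ ≤ ∑ i, ‖⟪𝐞 i, v⟫ • (𝐞 i : ℝ³)‖ := norm_sum_le _ _
    _ = ∑ i, |⟪v, 𝐞 i⟫| := by
        refine Finset.sum_congr rfl fun i _ => ?_
        rw [norm_smul, Real.norm_eq_abs, norm_basisFun, mul_one, real_inner_comm]

/-- `⟪∇f(x), v⟫ = Df(x) v`. [folklore] -/
theorem inner_gradient_left_eq_fderiv (f : ℝ³ → ℝ) (x v : ℝ³) :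
    ⟪gradient f x, v⟫ = fderiv ℝ f x v := by
  rw [gradient, InnerProductSpace.toDual_symm_apply]

/-- `‖∇f(x)‖ ≤ Σᵢ ‖∂ᵢ f(x)‖`. [folklore] -/
theorem norm_gradient_le_sum (f : ℝ³ → ℝ) (x : ℝ³) :
    ‖gradient f x‖ ≤ ∑ i, ‖fderiv ℝ f x (𝐞 i)‖ := by
  refine (norm_le_sum_abs_inner_basisFun _).trans_eq ?_
  refine Finset.sum_congr rfl fun i _ => ?_
  rw [inner_gradient_left_eq_fderiv, Real.norm_eq_abs]

/-- `‖Df(x)‖ ≤ Σᵢ ‖∂ᵢ f(x)‖` (operator norm of the differential of a scalar function).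
[folklore] -/
theorem norm_fderiv_le_sum (f : ℝ³ → ℝ) (x : ℝ³) :
    ‖fderiv ℝ f x‖ ≤ ∑ i, ‖fderiv ℝ f x (𝐞 i)‖ := by
  refine ContinuousLinearMap.opNorm_le_bound _ (Finset.sum_nonneg fun i _ => norm_nonneg _)
    fun v => ?_
  have hv := (𝐞).sum_repr' v
  calc ‖fderiv ℝ f x v‖ = ‖fderiv ℝ f x (∑ i, ⟪𝐞 i, v⟫ • (𝐞 i : ℝ³))‖ := by rw [hv]
    _ = ‖∑ i, ⟪𝐞 i, v⟫ * fderiv ℝ f x (𝐞 i)‖ := by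
        rw [map_sum]; simp only [map_smul, smul_eq_mul]
    _ ≤ ∑ i, ‖⟪𝐞 i, v⟫ * fderiv ℝ f x (𝐞 i)‖ := norm_sum_le _ _
    _ ≤ ∑ i, ‖fderiv ℝ f x (𝐞 i)‖ * ‖v‖ := by
        refine Finset.sum_le_sum fun i _ => ?_
        rw [norm_mul, mul_comm]
        gcongr
        refine (abs_real_inner_le_norm _ _).trans ?_
        rw [norm_basisFun, one_mul]
    _ = (∑ i, ‖fderiv ℝ f x (𝐞 i)‖) * ‖v‖ := by rw [Finset.sum_mul]

/-- From the directional bound to a bound for any `x ↦ V(x)` dominated by `Σᵢ ‖∂ᵢP[w](x)‖`.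
[folklore] -/
private theorem eLpNorm_le_of_le_sum_fderiv {p : ℝ≥0∞} (hp : 1 ≤ p) {C : ℝ≥0}
    (hC : ∀ ⦃w : ℝ³ → ℝ³⦄, ContDiff ℝ ∞ w → HasCompactSupport w → ∀ a : ℝ³, ‖a‖ ≤ 1 →
      eLpNorm (fun x => fderiv ℝ (potential w) x a) p volume ≤ C * eLpNorm w p volume)
    {F' : Type*} [NormedAddCommGroup F'] (hw : ContDiff ℝ ∞ w) (hwc : HasCompactSupport w)
    {V : ℝ³ → F'} (hV : ∀ x, ‖V x‖ ≤ ∑ i, ‖fderiv ℝ (potential w) x (𝐞 i)‖) :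
    eLpNorm V p volume ≤ (3 * C : ℝ≥0) * eLpNorm w p volume := by
  set G : Fin 3 → ℝ³ → ℝ := fun i x => ‖fderiv ℝ (potential w) x (𝐞 i)‖ with hG
  have hmeas : ∀ i, AEStronglyMeasurable (G i) volume := fun i =>
    ((((contDiff_infty.1 (contDiff_potential hw) 1).continuous_fderiv one_ne_zero).clm_apply
      continuous_const).norm).aestronglyMeasurable
  calc eLpNorm V p volume ≤ eLpNorm (∑ i, G i) p volume := by
        refine eLpNorm_mono_real fun x => ?_
        rw [Finset.sum_apply]
        exact hV x
    _ ≤ ∑ i, eLpNorm (G i) p volume := eLpNorm_sum_le (fun i _ => hmeas i) hp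
    _ ≤ ∑ _i : Fin 3, (C : ℝ≥0∞) * eLpNorm w p volume := by
        refine Finset.sum_le_sum fun i _ => ?_
        rw [hG, eLpNorm_norm]
        exact hC hw hwc (𝐞 i) (norm_basisFun i).le
    _ = (3 * C : ℝ≥0) * eLpNorm w p volume := by
        rw [Finset.sum_const, Finset.card_univ, Fintype.card_fin]
        push_cast
        ring

/-- **Calderón–Zygmund bound for the gradient of `P[w]`**: for `1 < p < ∞` there is `C = C(p)`
with `‖∇P[w]‖_{L^p(ℝ³)} ≤ C ‖w‖_{L^p(ℝ³)}` for all smooth compactly supported `w`.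
[cite: Stein1971, Ch. III §1.3 Prop 3] -/
theorem exists_eLpNorm_gradient_potential_le {p : ℝ≥0∞} (hp : 1 < p) (hp' : p < ⊤) :
    ∃ C : ℝ≥0, ∀ ⦃w : ℝ³ → ℝ³⦄, ContDiff ℝ ∞ w → HasCompactSupport w →
      eLpNorm (gradient (potential w)) p volume ≤ C * eLpNorm w p volume := by
  obtain ⟨C, hC⟩ := exists_eLpNorm_fderiv_potential_le hp hp'
  exact ⟨3 * C, fun w hw hwc =>
    eLpNorm_le_of_le_sum_fderiv hp.le hC hw hwc fun x => norm_gradient_le_sum _ x⟩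

/-- The same bound for the differential `x ↦ DP[w](x)` (operator norm). [folklore] -/
theorem exists_eLpNorm_fderiv_potential_le' {p : ℝ≥0∞} (hp : 1 < p) (hp' : p < ⊤) :
    ∃ C : ℝ≥0, ∀ ⦃w : ℝ³ → ℝ³⦄, ContDiff ℝ ∞ w → HasCompactSupport w →
      eLpNorm (fderiv ℝ (potential w)) p volume ≤ C * eLpNorm w p volume := by
  obtain ⟨C, hC⟩ := exists_eLpNorm_fderiv_potential_le hp hp'
  exact ⟨3 * C, fun w hw hwc =>
    eLpNorm_le_of_le_sum_fderiv hp.le hC hw hwc fun x => norm_fderiv_le_sum _ x⟩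

/-! ### The Laplacian of `P[w]`; removing the gradient part on a ball -/

/-- `ΔP[w] = div w - Λ[div w]` (Green's representation at scale `8`). [folklore] -/
theorem laplacian_potential (hw : ContDiff ℝ ∞ w) (x : ℝ³) :
    Δ (potential w) x =
      VectorCalculus.divergence w x - newtonFarSmoothing 4 8 (VectorCalculus.divergence w) x :=
  laplacian_newtonNearPotential (by norm_num) (by norm_num)
    (contDiff_infty.1 (contDiff_divergence_top hw) 2) x

/-- The smoothing remainder `Λ[g](x)` only sees `g` on the annulus `4 ≤ |x - y| ≤ 8`: it
vanishes when `g(x - z) = 0` for all `4 ≤ ‖z‖ ≤ 8`. [folklore] -/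
theorem newtonFarSmoothing_eq_zero_of_annulus {g : ℝ³ → ℝ} {x : ℝ³}
    (h : ∀ z : ℝ³, 4 ≤ ‖z‖ → ‖z‖ ≤ 8 → g (x - z) = 0) : newtonFarSmoothing 4 8 g x = 0 := by
  rw [newtonFarSmoothing_apply]
  refine integral_eq_zero_of_ae (Eventually.of_forall fun z => ?_)
  simp only [Pi.zero_apply]
  by_cases hz : 4 ≤ ‖z‖
  · by_cases hz' : ‖z‖ ≤ 8
    · rw [h z hz hz', mul_zero]
    · rw [newtonFarLaplacian_eq_zero_of_gt (by norm_num) (by norm_num) (not_le.1 hz'), zero_mul]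
  · rw [newtonFarLaplacian_eq_zero_of_lt (by norm_num) (by norm_num) (not_le.1 hz), zero_mul]

/-- **`ΔP[w] = div w` on `B(c, 2)` when `w` is supported in `B(c, 2)`**: for `x ∈ B(c, 2)` and
`‖z‖ ≥ 4` the point `x - z` is outside `B(c, 2)`, so the smoothing remainder vanishes at `x`.
[folklore] -/
theorem laplacian_potential_eq_divergence (hw : ContDiff ℝ ∞ w) {c : ℝ³}
    (hsupp : tsupport w ⊆ ball c 2) {x : ℝ³} (hx : x ∈ ball c 2) :
    Δ (potential w) x = VectorCalculus.divergence w x := by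
  rw [laplacian_potential hw, newtonFarSmoothing_eq_zero_of_annulus, sub_zero]
  intro z hz _
  refine divergence_eq_zero_of_notMem_tsupport fun hmem => ?_
  have h1 : dist (x - z) c < 2 := mem_ball.1 (hsupp hmem)
  have h2 : dist x c < 2 := mem_ball.1 hx
  have h3 : ‖z‖ ≤ dist x c + dist (x - z) c := by
    calc ‖z‖ = ‖(x - c) - (x - z - c)‖ := by congr 1; abel
      _ ≤ ‖x - c‖ + ‖x - z - c‖ := norm_sub_le _ _
      _ = dist x c + dist (x - z) c := by rw [dist_eq_norm, dist_eq_norm]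
  linarith

/-- **The gradient part is removed on the ball**: for smooth `w` supported in `B(c, 2)`, the
field `w - ∇P[w]` is divergence free on `B(c, 2)` (`div ∇ = Δ`). [cite: CaffarelliKohnNirenberg1982, §1] -/
theorem divergence_sub_gradient_potential_eq_zero (hw : ContDiff ℝ ∞ w) {c : ℝ³}
    (hsupp : tsupport w ⊆ ball c 2) {x : ℝ³} (hx : x ∈ ball c 2) :
    VectorCalculus.divergence (fun y => w y - gradient (potential w) y) x = 0 := by
  have hP2 : ContDiff ℝ 2 (potential w) := contDiff_infty.1 (contDiff_potential hw) 2
  have hgrad : ContDiff ℝ 1 (gradient (potential w)) :=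
    (InnerProductSpace.toDual ℝ ℝ³).symm.contDiff.comp (hP2.fderiv_right (m := 1) le_rfl)
  rw [divergence_sub_apply ((contDiff_infty.1 hw 1).differentiable one_ne_zero x)
    (hgrad.differentiable one_ne_zero x), divergence_gradient hP2,
    laplacian_potential_eq_divergence hw hsupp hx, sub_self]

/-! ### The `L^{3/2}` bound for `P[w]` (Sobolev and Calderón–Zygmund at `p = 3/2`) -/

/-- `1 < 3/2 < ∞` in `ℝ≥0∞`, in the coerced form `((3/2 : ℝ≥0) : ℝ≥0∞)`. [folklore] -/
private theorem threeHalves_facts :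
    (1 : ℝ≥0∞) < ((3 / 2 : ℝ≥0) : ℝ≥0∞) ∧ ((3 / 2 : ℝ≥0) : ℝ≥0∞) < ⊤ := by
  refine ⟨?_, ENNReal.coe_lt_top⟩
  have : (1 : ℝ≥0) < 3 / 2 := by norm_num
  exact_mod_cast this

/-- **Sobolev step**: there is an absolute `C` with `‖P[w]‖_{L³(ℝ³)} ≤ C ‖w‖_{L^{3/2}(ℝ³)}` for all
smooth compactly supported `w` (Gagliardo–Nirenberg–Sobolev `‖u‖_{L³} ≤ C_S ‖Du‖_{L^{3/2}}` in
dimension `3` for the compactly supported `C¹` function `u = P[w]`, and the Calderón–Zygmund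
bound at `p = 3/2`). [folklore] -/
theorem exists_eLpNorm_potential_three_le :
    ∃ C : ℝ≥0, ∀ ⦃w : ℝ³ → ℝ³⦄, ContDiff ℝ ∞ w → HasCompactSupport w →
      eLpNorm (potential w) ((3 : ℝ≥0) : ℝ≥0∞) volume ≤
        C * eLpNorm w ((3 / 2 : ℝ≥0) : ℝ≥0∞) volume := by
  obtain ⟨C, hC⟩ := exists_eLpNorm_fderiv_potential_le' threeHalves_facts.1 threeHalves_facts.2
  set CS : ℝ≥0 := eLpNormLESNormFDerivOfEqInnerConst (volume : Measure ℝ³) ((3 / 2 : ℝ≥0) : ℝ)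
    with hCS
  refine ⟨CS * C, fun w hw hwc => ?_⟩
  have h1 : ContDiff ℝ 1 (potential w) := contDiff_infty.1 (contDiff_potential hw) 1
  have hdim : 0 < Module.finrank ℝ ℝ³ := by rw [finrank_euclideanSpace_fin]; norm_num
  have hexp : ((3 : ℝ≥0) : ℝ)⁻¹ = ((3 / 2 : ℝ≥0) : ℝ)⁻¹ - (Module.finrank ℝ ℝ³ : ℝ)⁻¹ := by
    rw [finrank_euclideanSpace_fin]; push_cast; norm_num
  have hp32 : (1 : ℝ≥0) ≤ 3 / 2 := by
    rw [← NNReal.coe_le_coe]; push_cast; norm_num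
  have hS := eLpNorm_le_eLpNorm_fderiv_of_eq_inner (μ := (volume : Measure ℝ³)) h1
    (hasCompactSupport_potential hwc) (p := 3 / 2) (p' := 3) hp32 hdim hexp
  calc eLpNorm (potential w) ((3 : ℝ≥0) : ℝ≥0∞) volume
      ≤ CS * eLpNorm (fderiv ℝ (potential w)) ((3 / 2 : ℝ≥0) : ℝ≥0∞) volume := by
        simpa only [hCS] using hS
    _ ≤ CS * (C * eLpNorm w ((3 / 2 : ℝ≥0) : ℝ≥0∞) volume) := by
        gcongr
        exact hC hw hwc
    _ = (CS * C : ℝ≥0) * eLpNorm w ((3 / 2 : ℝ≥0) : ℝ≥0∞) volume := by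
        push_cast; ring

/-- The volume of the ball `B̄(c, 10)` of `ℝ³` does not depend on the centre and is finite.
[folklore] -/
theorem volume_closedBall_ten (c : ℝ³) :
    volume (closedBall c 10) = volume (closedBall (0 : ℝ³) 10) ∧ volume (closedBall c 10) < ⊤ := by
  refine ⟨?_, measure_closedBall_lt_top⟩
  rw [Measure.addHaar_closedBall_center]

/-- **The `L^{3/2}` bound**: there is an absolute `C` such that for every centre `c` and every
smooth `w` supported in `B(c, 2)`, `‖P[w]‖_{L^{3/2}(ℝ³)} ≤ C ‖w‖_{L^{3/2}(ℝ³)}` (`P[w]` is supported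
in `B̄(c, 10)`, where `L³` controls `L^{3/2}` by Hölder). [folklore] -/
theorem exists_eLpNorm_potential_le :
    ∃ C : ℝ≥0, ∀ (c : ℝ³) ⦃w : ℝ³ → ℝ³⦄, ContDiff ℝ ∞ w → HasCompactSupport w →
      tsupport w ⊆ ball c 2 →
      eLpNorm (potential w) ((3 / 2 : ℝ≥0) : ℝ≥0∞) volume ≤
        C * eLpNorm w ((3 / 2 : ℝ≥0) : ℝ≥0∞) volume := by
  obtain ⟨C, hC⟩ := exists_eLpNorm_potential_three_le
  -- the Hölder factor `|B̄(0,10)|^{1/(3/2) - 1/3}`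
  set V : ℝ≥0∞ := volume (closedBall (0 : ℝ³) 10) with hV
  have hVtop : V ≠ ⊤ := measure_closedBall_lt_top.ne
  set K : ℝ≥0∞ := V ^ (1 / ((3 / 2 : ℝ≥0) : ℝ≥0∞).toReal - 1 / ((3 : ℝ≥0) : ℝ≥0∞).toReal) with hK
  have hKexp : (0 : ℝ) ≤ 1 / ((3 / 2 : ℝ≥0) : ℝ≥0∞).toReal - 1 / ((3 : ℝ≥0) : ℝ≥0∞).toReal := by
    rw [ENNReal.coe_toReal, ENNReal.coe_toReal]; push_cast; norm_num
  have hKtop : K ≠ ⊤ := by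
    rw [hK]
    exact ENNReal.rpow_ne_top_of_nonneg hKexp hVtop
  refine ⟨K.toNNReal * C, fun c w hw hwc hsupp => ?_⟩
  have hPsupp : tsupport (potential w) ⊆ closedBall c 10 := by
    have := tsupport_potential_subset (w := w) hsupp
    norm_num at this
    exact this
  have hzero : ∀ x, x ∉ closedBall c 10 → potential w x = 0 := fun x hx =>
    image_eq_zero_of_notMem_tsupport fun h => hx (hPsupp h)
  -- restrict to the ball
  have hrestr : eLpNorm (potential w) ((3 / 2 : ℝ≥0) : ℝ≥0∞) volume =
      eLpNorm (potential w) ((3 / 2 : ℝ≥0) : ℝ≥0∞) (volume.restrict (closedBall c 10)) := by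
    rw [← eLpNorm_indicator_eq_eLpNorm_restrict measurableSet_closedBall]
    congr 1
    funext x
    by_cases hx : x ∈ closedBall c 10
    · rw [indicator_of_mem hx]
    · rw [indicator_of_notMem hx, hzero x hx]
  have hmeas : AEStronglyMeasurable (potential w) (volume.restrict (closedBall c 10)) :=
    (contDiff_potential hw).continuous.aestronglyMeasurable
  have hle : ((3 / 2 : ℝ≥0) : ℝ≥0∞) ≤ ((3 : ℝ≥0) : ℝ≥0∞) := by
    have : (3 / 2 : ℝ≥0) ≤ 3 := by norm_num
    exact_mod_cast this
  have hHolder := eLpNorm_le_eLpNorm_mul_rpow_measure_univ hle hmeas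
  rw [Measure.restrict_apply_univ, (volume_closedBall_ten c).1] at hHolder
  calc eLpNorm (potential w) ((3 / 2 : ℝ≥0) : ℝ≥0∞) volume
      = eLpNorm (potential w) ((3 / 2 : ℝ≥0) : ℝ≥0∞) (volume.restrict (closedBall c 10)) := hrestr
    _ ≤ eLpNorm (potential w) ((3 : ℝ≥0) : ℝ≥0∞) (volume.restrict (closedBall c 10)) * K := hHolder
    _ ≤ eLpNorm (potential w) ((3 : ℝ≥0) : ℝ≥0∞) volume * K := by
        exact mul_le_mul_left (eLpNorm_mono_measure (potential w) Measure.restrict_le_self) _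
    _ ≤ (C * eLpNorm w ((3 / 2 : ℝ≥0) : ℝ≥0∞) volume) * K := by
        gcongr
        exact hC hw hwc
    _ = (K.toNNReal * C : ℝ≥0) * eLpNorm w ((3 / 2 : ℝ≥0) : ℝ≥0∞) volume := by
        rw [ENNReal.coe_mul, ENNReal.coe_toNNReal hKtop]
        ring

end LocalHelmholtz

end Literature.Analysis.FluidPDE

end
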